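import Literature.MathematicalPhysics.QuantumFieldTheory.Balaban1983to89.B7Eq122LinearPartIsLinear
import Literature.MathematicalPhysics.QuantumFieldTheory.Balaban1983to89.B9Eq324LevelWeights

/-!
# `Balaban1983to89.B9Eq316FormZd` — [Balaban1985BackgroundPropagators] p. 393, display (3.16): the quadratic form
# `⟨A, Q*aQA⟩ = Σ_{j=0}^{k} a Σ_{b∈Λ_j} (Lʲη)^{d−2}|(Q_j(U)A)(b)|²` WITH BODY on the carrier of print's own averaging operators —
# the [5] unit lattice `ℤᵈ` at a general background `U₀ := U`, `Q_j(U)` = `(Lʲ)⁻¹·QjOp` (row B9.Eq3.13, `B7Eq122LinearPartIsLinear`),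
# the multiscale partition `Λ_j` as finite-set letters — seat r06 (B9 fold owner) gen 24, row B9.Eq3.16

statement-level skeleton of published theorems with citation tags; proofs where landed; nothing here is a claim about the Yang–Mills mass gap

CITATION HEADER (lean-in-tree rule).  T. Bałaban, *Propagators for lattice gauge theories in a background field*, Commun. Math. Phys. **99**
(1985) 389–434 [Balaban1985BackgroundPropagators] (held `paper:balaban1985-cmp99-background-propagators`, journal page = PDF page + 388; render
`b2b-balaban-ref1/pages/1985-cmp99-background-propagators/…-p005-x2.png` re-read as an image by this seat 2026-08-23).  p. 393 [PDF 5]: «To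
introduce an operator similar to the operator Q*aQ of the paper [4] (see (2.20), (2.14)), we need the geometric setting of that paper. We refer
the reader to the beginning of Sect. A of [4], especially to (2.1)–(2.4). The only change we make is that the sequence (2.1) starts with Ω₀, thus
we have Ω₀ ⊃ Ω₁ ⊃ ⋯ ⊃ Ω_k, Ω_j ⊂ T_η, and we define Λ_j = Ω_j^{(j)} \ Ω_{j+1}^{(j)}, j = 0, 1, …, k, Ω_{k+1} = ∅, or Ω_j \ Ω_{j+1} = Bʲ(Λ_j), hence
Λ_j ⊂ T^{(j)}_{Lʲη}. The condition (2.2) is unchanged. We have introduced the domain Ω₀ because we will consider operators with Dirichlet boundary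
conditions on Ω₀ᶜ. We define an operator Q*aQ by the quadratic form ⟨A, Q*aQA⟩ = Σ_{j=0}^{k} a Σ_{b∈Λ_j} (Lʲη)^{d−2}|(Q_j(U)A)(b)|². (3.16)»; (3.14)–(3.15)
p. 393 (the linear averaging operators `Q_j(U)`, row B9.Eq3.13).  [Balaban1985Averaging] = [5]: (124) p. 36, (127) p. 37 (the objects `QjOp` is made of).

WHAT IS PROVED (one definition WITH BODY + theorems; 0 named fact, 0 sorry, standard axioms).  Carrier = the [5] unit lattice
`B7Prop1Explicit.Site d = ℤᵈ` of rows B9.Eq3.13/3.55/3.58, bond functions `A : B7Prop1Explicit.Site d → Fin d → 𝔸` (`𝔸` a complete normed ℂ-algebra, |·| = its norm,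
as in every [5] file), the regularity letters of `B7Eq122LinearPartIsLinear.QjOp` (unit-bounded, α-regular averaged backgrounds — [5] Prop. 2's
conclusions, print p. 395 «Assuming some regularity of the configuration U»).  Print's `Q_j(U)` = `(Lʲ)⁻¹ • QjOp … j` (`QjOp` = the UN-normalised
composite `Lʲ·Q_j(U)`, READING C-adv4-22 — lead g12 HEAD WORD Q-B9-24-4).
* **`form316`** — THE DISPLAY (3.16) as a definition WITH BODY: `form316 … Λ k a η A = Σ_{j ≤ k} a·Σ_{b ∈ Λ j} (Lʲη)^{(d:ℤ)−2}·‖((Lʲ)⁻¹ • QjOp j A)(b)‖²`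
  with the coefficient `a(Lʲη)^{d−2}` = `B9Eq324LevelWeights.coeff316 a L η d j` (the SAME constant `a` at every level, as printed — contrast (3.24)'s `a_j`),
  `Λ : ℕ → Finset (B7Prop1Explicit.Site d × Fin d)` the letters «Λ_j, j = 0, …, k, Ω_{k+1} = ∅» (the level-`j` bonds read on the unit lattice after `j` rescalings).
* `form316_eq` (unfolding), `form316_nonneg` (`a ≧ 0`), `form316_zero`, **`form316_smul`** (`⟨cA, Q*aQ(cA)⟩ = |c|²⟨A, Q*aQA⟩` — it IS a quadratic
  form of the ℂ-linear `Q_j(U)`), `form316_le_of_le` (monotone in `a`), `form316_level_zero` (the `j = 0` term is `a·η^{d−2}Σ_{b∈Λ₀}|A(b)|²`: `Q₀(U) = I`).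
HONEST SCOPE.  (i) The display (3.16) is typed as the real-valued QUADRATIC FORM it prints; the OPERATOR `Q*aQ` «defined by the quadratic form»
(Riesz/polarization in `L²(T_η, 𝔤)`) is consumed at (3.26) and lives in row B9.Eq3.26's files (`B9Eq326OperatorAssembly.laplaceAofU`, NE9
`B9Eq326OperatorTower.laplaceAk`; the parameter-`Q` display shape on the b09 Hilbert carrier is `B9Eq324LevelWeights.form316`/`qaq316`) — not
constructed on this carrier.  (ii) `Λ_j` are letters (finite sets of level-`j` bonds); the geometry (2.1)–(2.4) of [4] (Ω_j, Bʲ(Λ_j), (2.2)) is not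
modelled here (rows B6/B9.Eq3.18's block systems).  (iii) `|·|` = the norm of `𝔸` (print: the invariant norm on `𝔤 ⊂ u(N)`).  NOT summit progress.

RELATED IN THE TREE, NOT DUPLICATED (searched 2026-08-23: `lean search --decl 'form316|qaq316|levelOp'`): `B9Eq324LevelWeights.form316` (r06 g24 FILE 65:
the display SHAPE for a PARAMETER linear `Q` on the b09 carrier, with the operator `qaq316`), `B9Thm37GlueTorusCovLevels.levelSum`/`levelOp` (models with
free `a_j`), NE9 `B9Eq315QTower.QkOfU` (the composite on tori, `QkOfU_apply_eq_linCovIter`).  Here: print's own `Q_j(U)` on the [5] carrier, level sum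
with the printed coefficients.
-/

noncomputable section

namespace Literature.MathematicalPhysics.QuantumFieldTheory.Balaban1983to89.B9Eq316FormZd

open Literature.MathematicalPhysics.QuantumFieldTheory.Balaban1983to89
open Literature.MathematicalPhysics.QuantumFieldTheory.Balaban1983to89.B7Prop1Explicit (U1 Wcx boxVec)
open Literature.MathematicalPhysics.QuantumFieldTheory.Balaban1983to89.B7Prop2Explicit (avgIter)
open Literature.MathematicalPhysics.QuantumFieldTheory.Balaban1983to89.B7Eq122LinearPartIsLinear (QjOp QjOp_zero)
open Literature.MathematicalPhysics.QuantumFieldTheory.Balaban1983to89.B9Eq324LevelWeights (coeff316)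
open Literature.MathematicalPhysics.QuantumFieldTheory.Balaban1983to89.LatticeNorms (scaleLen)

variable {d : ℕ} {𝔸 : Type*} [NormedRing 𝔸] [NormedAlgebra ℂ 𝔸] [CompleteSpace 𝔸] [NormOneClass 𝔸]
variable {L : ℕ} {U : B7Prop1Explicit.Site d → Fin d → 𝔸ˣ} {α : ℝ}
variable (hL : 1 ≤ L) (hα1 : α ≤ 1 / 64) (hU1 : ∀ (i : ℕ) (x : B7Prop1Explicit.Site d) (κ : Fin d), avgIter L U i x κ ∈ U1 𝔸)
  (hreg : ∀ (i : ℕ) (q : B7Prop1Explicit.Site d) (κ : Fin d) (r : Fin d → Fin L), ‖((Wcx L (avgIter L U i) q κ (boxVec L r) : 𝔸ˣ) : 𝔸) - 1‖ ≤ α)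

/-- **THE DISPLAY (3.16)**: `⟨A, Q*aQA⟩ = Σ_{j=0}^{k} a Σ_{b∈Λ_j} (Lʲη)^{d−2}|(Q_j(U)A)(b)|²` — the quadratic form of print's multi-level averaging,
with `Q_j(U)A = (Lʲ)⁻¹·(QjOp j A)` (row B9.Eq3.13's linear averaging operator (3.14)–(3.15) on the [5] carrier), the SAME constant `a` at every
level, the weights `(Lʲη)^{d−2}` (`coeff316`), and the level sets `Λ_j` (`j = 0, …, k`) as finite sets of level-`j` bonds.
[cite: Balaban1985BackgroundPropagators, (3.16) p.393, (3.14)–(3.15) p.393] -/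
def form316 (Λ : ℕ → Finset (B7Prop1Explicit.Site d × Fin d)) (k : ℕ) (a η : ℝ) (A : B7Prop1Explicit.Site d → Fin d → 𝔸) : ℝ :=
  ∑ j ∈ Finset.range (k + 1), a * ∑ b ∈ Λ j, scaleLen (L : ℝ) η j ^ ((d : ℤ) - 2) *
    ‖(((L : ℝ) ^ j)⁻¹ : ℝ) • QjOp hL hα1 hU1 hreg j A b.1 b.2‖ ^ 2

/-- (3.16) unfolded, with the printed coefficient `a(Lʲη)^{d−2}` = `coeff316 a L η d j` pulled in front of each level sum.
[cite: Balaban1985BackgroundPropagators, (3.16) p.393] -/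
theorem form316_eq (Λ : ℕ → Finset (B7Prop1Explicit.Site d × Fin d)) (k : ℕ) (a η : ℝ) (A : B7Prop1Explicit.Site d → Fin d → 𝔸) :
    form316 hL hα1 hU1 hreg Λ k a η A =
      ∑ j ∈ Finset.range (k + 1), coeff316 a (L : ℝ) η d j *
        ∑ b ∈ Λ j, ‖(((L : ℝ) ^ j)⁻¹ : ℝ) • QjOp hL hα1 hU1 hreg j A b.1 b.2‖ ^ 2 := by
  unfold form316
  refine Finset.sum_congr rfl fun j _ => ?_
  rw [coeff316, Finset.mul_sum, Finset.mul_sum]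
  refine Finset.sum_congr rfl fun b _ => ?_
  ring

/-- `⟨A, Q*aQA⟩ ≧ 0` for `a ≧ 0`, `L, η ≧ 0`. [cite: Balaban1985BackgroundPropagators, (3.16) p.393] -/
theorem form316_nonneg (Λ : ℕ → Finset (B7Prop1Explicit.Site d × Fin d)) (k : ℕ) {a η : ℝ} (ha : 0 ≤ a) (hη : 0 ≤ η) (A : B7Prop1Explicit.Site d → Fin d → 𝔸) :
    0 ≤ form316 hL hα1 hU1 hreg Λ k a η A := by
  unfold form316
  refine Finset.sum_nonneg fun j _ => mul_nonneg ha (Finset.sum_nonneg fun b _ => mul_nonneg ?_ (pow_two_nonneg _))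
  exact zpow_nonneg (mul_nonneg (pow_nonneg (Nat.cast_nonneg L) j) hη) _

/-- `⟨0, Q*aQ0⟩ = 0`. [cite: Balaban1985BackgroundPropagators, (3.16) p.393] -/
theorem form316_zero (Λ : ℕ → Finset (B7Prop1Explicit.Site d × Fin d)) (k : ℕ) (a η : ℝ) :
    form316 hL hα1 hU1 hreg Λ k a η (0 : B7Prop1Explicit.Site d → Fin d → 𝔸) = 0 := by
  unfold form316
  refine Finset.sum_eq_zero fun j _ => ?_
  rw [map_zero]
  simp

/-- **(3.16) IS a quadratic form of the linear `Q_j(U)`**: `⟨cA, Q*aQ(cA)⟩ = |c|²·⟨A, Q*aQA⟩` for every `c ∈ ℂ` (ℂ-linearity of `QjOp`,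
`B7Eq122LinearPartIsLinear`). [cite: Balaban1985BackgroundPropagators, (3.16) p.393, (3.14) p.393] -/
theorem form316_smul (Λ : ℕ → Finset (B7Prop1Explicit.Site d × Fin d)) (k : ℕ) (a η : ℝ) (c : ℂ) (A : B7Prop1Explicit.Site d → Fin d → 𝔸) :
    form316 hL hα1 hU1 hreg Λ k a η (c • A) = ‖c‖ ^ 2 * form316 hL hα1 hU1 hreg Λ k a η A := by
  unfold form316
  rw [Finset.mul_sum]
  refine Finset.sum_congr rfl fun j _ => ?_
  have hpt : ∀ b : B7Prop1Explicit.Site d × Fin d,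
      ‖(((L : ℝ) ^ j)⁻¹ : ℝ) • QjOp hL hα1 hU1 hreg j (c • A) b.1 b.2‖ ^ 2 =
        ‖c‖ ^ 2 * ‖(((L : ℝ) ^ j)⁻¹ : ℝ) • QjOp hL hα1 hU1 hreg j A b.1 b.2‖ ^ 2 := by
    intro b
    rw [map_smul, Pi.smul_apply, Pi.smul_apply, smul_comm, norm_smul, mul_pow]
  simp_rw [hpt]
  rw [Finset.mul_sum, Finset.mul_sum, Finset.mul_sum]
  refine Finset.sum_congr rfl fun b _ => ?_
  ring

/-- Monotone in the constant `a`: `⟨A, Q*aQA⟩ ≦ ⟨A, Q*a′QA⟩` for `a ≦ a′` (`L, η ≧ 0`). [cite: Balaban1985BackgroundPropagators, (3.16) p.393] -/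
theorem form316_le_of_le (Λ : ℕ → Finset (B7Prop1Explicit.Site d × Fin d)) (k : ℕ) {a a' η : ℝ} (haa' : a ≤ a') (hη : 0 ≤ η)
    (A : B7Prop1Explicit.Site d → Fin d → 𝔸) : form316 hL hα1 hU1 hreg Λ k a η A ≤ form316 hL hα1 hU1 hreg Λ k a' η A := by
  unfold form316
  refine Finset.sum_le_sum fun j _ => mul_le_mul_of_nonneg_right haa' (Finset.sum_nonneg fun b _ => mul_nonneg ?_ (pow_two_nonneg _))
  exact zpow_nonneg (mul_nonneg (pow_nonneg (Nat.cast_nonneg L) j) hη) _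

/-- **The `j = 0` term of (3.16)**: `Q₀(U) = I` (no averaging on `Λ₀`), so the level-`0` contribution is `a·η^{d−2}·Σ_{b∈Λ₀}|A(b)|²`.
[cite: Balaban1985BackgroundPropagators, (3.16) p.393, (3.15) p.393] -/
theorem form316_level_zero (Λ : ℕ → Finset (B7Prop1Explicit.Site d × Fin d)) (a η : ℝ) (A : B7Prop1Explicit.Site d → Fin d → 𝔸) :
    form316 hL hα1 hU1 hreg Λ 0 a η A = a * ∑ b ∈ Λ 0, η ^ ((d : ℤ) - 2) * ‖A b.1 b.2‖ ^ 2 := by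
  unfold form316
  rw [zero_add, Finset.sum_range_one, QjOp_zero]
  congr 1
  refine Finset.sum_congr rfl fun b _ => ?_
  rw [scaleLen, pow_zero, one_mul, LinearMap.id_apply]
  simp

end Literature.MathematicalPhysics.QuantumFieldTheory.Balaban1983to89.B9Eq316FormZd

end
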